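import Literature.NumberTheory.Automorphic.QuadraticArchimedeanBaseChange
import HarnessLib

/-!
# Quadratic base change for the adeles: `𝔸_E^∞ = 𝔸_F^∞ ⊕ 𝔸_F^∞ δ` and `𝔸_E = 𝔸_F ⊕ 𝔸_F δ`
(`E ⊗_F 𝔸_F ≅ 𝔸_E`, Cassels–Fröhlich, *Algebraic Number Theory* (1967), Ch. II §14, in the basis `(1, δ)` of a
quadratic extension; the local statement `E ⊗_F F_v ≅ ∏_{w ∣ v} E_w` is Ch. II §§9–10)

Topic `NumberTheory/Automorphic`; namespace `Literature.NumberTheory.Automorphic.UnitaryGroup` (third part of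
`QuadraticLocalBaseChange` (finite places) and `QuadraticArchimedeanBaseChange` (infinite places)). Definitions and
proved lemmas only: **no named facts, 0 proof holes**.

**Setting.** `E/F` number fields; for the quadratic statements `[Algebra.IsQuadraticExtension F E]`, `σ ∈ Aut(E/F)` and
`δ ∈ E` with `σ δ = -δ ≠ 0` (such `σ, δ` exist: `exists_algEquiv_apply_eq_neg`), so that `E = F ⊕ F δ` and `δ ∉ F`.
`a ⊗ 1` denotes the tree's base-change maps `FiniteAdeleRing.baseChange (𝓞 F) F E (𝓞 E) : 𝔸_F^∞ → 𝔸_E^∞` and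
`AdeleRing.baseChange F E : 𝔸_F → 𝔸_E` (`AdeleBaseChange`).

* §1 `finiteAdeleToLocal v : 𝔸_E^∞ →+* ∏_{w ∣ v} E_w` (the components above a finite place `v` of `F`), its
  compatibility with `a ⊗ 1` and `ι_v : F_v → ∏_{w ∣ v} E_w` (`finiteAdeleToLocal_baseChange`), integrality under
  `ι_w` (`toPlace_mem_adicCompletionIntegers_iff`), and `e ∈ 𝒪_w^×` for almost all `w` when `e ≠ 0`
  (`eventually_valued_algebraMap_eq_one`).
* §2 the finite adeles, quadratic case: `Ψ^∞ : 𝔸_F^∞ × 𝔸_F^∞ → 𝔸_E^∞`, `(a, b) ↦ (a ⊗ 1) + (b ⊗ 1) · δ`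
  (`quadraticFiniteAdeleMap`) is the local `Ψ_v` of `QuadraticLocalBaseChange` above each `v`
  (`finiteAdeleToLocal_quadraticFiniteAdeleMap`), `(· ⊗ 1)`-semilinear (`quadraticFiniteAdeleMap_smul`), with
  `δ · Ψ^∞ (a, b) = Ψ^∞ (d b, a)` for `δ² = d ∈ F`; it is **injective** (the `σ ⊗ 1`-trick place by place) and
  **surjective**: local surjectivity of `Ψ_v` plus the **integrality of coordinates**
  `coords_mem_adicCompletionIntegers` — at a place `v ∤ 2` with `δ ∈ 𝒪_w^×` for all `w ∣ v`, if `ι_v a + ι_v b · δ` is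
  integral above `v` then so are `a, b` (apply `σ ⊗ 1` and solve; these conditions hold at almost all `v`) — so the
  local preimages form a finite adele. Whence `quadraticFiniteAdeleEquiv : (𝔸_F^∞ × 𝔸_F^∞) ≃+ 𝔸_E^∞` and
  `existsUnique_eq_baseChange_add`.
* §3 topology: `Ψ^∞` is continuous, and so is its inverse (`RestrictedProduct.continuous_dom`: on each
  `𝔸_{E,S}^∞ = ∏_{w ∈ S} E_w × ∏_{w ∉ S} 𝒪_w` the inverse factors through some `𝔸_{F,T}^∞ × 𝔸_{F,T}^∞` by §2's integrality
  of coordinates and is given by the continuous local inverses `Ψ_v⁻¹`):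
  **`quadraticFiniteAdeleContinuousEquiv : (𝔸_F^∞ × 𝔸_F^∞) ≃ₜ+ 𝔸_E^∞`**.
* §4 the adele ring: `Ψ_𝔸 = (Ψ_∞, Ψ^∞) : 𝔸_F × 𝔸_F → 𝔸_E`, `(a, b) ↦ (a ⊗ 1) + (b ⊗ 1) · δ` with `Ψ_∞` the
  archimedean isomorphism `quadraticInfiniteAdeleEquiv` of `QuadraticArchimedeanBaseChange`:
  **`quadraticAdeleEquiv : (𝔸_F × 𝔸_F) ≃ₜ+ 𝔸_E`**, `(· ⊗ 1)`-semilinear (`quadraticAdeleMap_smul`: `𝔸_E` is a free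
  `𝔸_F`-module of rank `2` on `(1, δ)`), `Ψ_𝔸 (x, y) = x + y δ` on `F × F` (`quadraticAdeleMap_algebraMap`),
  `δ · Ψ_𝔸 (a, b) = Ψ_𝔸 (d b, a)` (`algebraMap_mul_quadraticAdeleMap`), `existsUnique_eq_adeleBaseChange_add`, and the
  parameter-free `nonempty_quadraticAdeleEquiv`.

## Mathlib / tree

Mathlib: `IsDedekindDomain.FiniteAdeleRing` as a `RestrictedProduct` (+ `RestrictedProduct.continuous_dom`,
`continuous_inclusion`, `continuous_rng_of_principal`, `continuous_eval`, `FiniteAdeleRing.isUnit_iff`),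
`HeightOneSpectrum.adicCompletion` / `adicCompletionIntegers`, `NumberField.AdeleRing = InfiniteAdeleRing × FiniteAdeleRing`;
Mathlib does not record `𝔸_L ≅ 𝔸_K ⊗_K L`. Tree: `AdeleBaseChange` (`FiniteAdeleRing.baseChange`, `AdeleRing.baseChange`
and their `apply`/continuity/`algebraMap`/injectivity lemmas), `AdelicGroupData` (`finiteAdeleEval`), `GaloisActionPlaces`
(`galAdicCompletionMap_mem_adicCompletionIntegers_iff`), `UnitaryGroupAutomorphicRep` (`PlacesOver`, `LocalRing`,
`conjLocal`), `QuadraticLocalBaseChange` (`toPlace`, `toLocalRing`, `quadraticLocalMap`/`quadraticLocalEquiv`, its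
surjectivity and continuity, `not_mem_range_algebraMap_of_apply_eq_neg`, `exists_algEquiv_apply_eq_neg`),
`QuadraticArchimedeanBaseChange` (`quadraticInfiniteAdeleMap`/`quadraticInfiniteAdeleEquiv`).

## Provenance

Written under the LEAN-IN-TREE rule (2026-08-18) for the pub-hodgecm formalisation cell (model-construction sub-cell,
base-change junction `E ⊗_F 𝔸_F = 𝔸_E` between the unitary group `U(V)(𝔸_F) ≤ GL₃(E ⊗_F 𝔸_F)` and the carriers
`GL₃(𝔸_E)`, `∏_{w ∣ v} GL₃(E_w)`). Nothing in this file is a claim of the manuscripts adjudicated by that cell.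

## References

* J. W. S. Cassels, A. Fröhlich (eds.), *Algebraic Number Theory* (1967), Ch. II §§9–10, §14 [CasselsFrohlichANT1967].
* J. Neukirch, *Algebraic Number Theory*, Grundlehren 322 (1999), Ch. II (8.3), Ch. VI §1 [Neukirch1999].
-/

noncomputable section

open NumberField IsDedekindDomain Topology Filter

namespace Literature.NumberTheory.Automorphic

namespace UnitaryGroup

variable {F : Type} (E : Type) [Field F] [NumberField F] [Field E] [NumberField E] [Algebra F E]

/-! ## 1. Finite adeles at the places above `v`; integrality transfer -/

section FiniteAdeleLocal

/-- The projection `𝔸_E^∞ →+* E ⊗_F F_v = ∏_{w ∣ v} E_w` onto the components above `v`. [folklore] -/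
def finiteAdeleToLocal (v : HeightOneSpectrum (𝓞 F)) : FiniteAdeleRing (𝓞 E) E →+* LocalRing E v :=
  RingHom.pi fun w : PlacesOver E v => AdelicGroupData.finiteAdeleEval E w.1

omit [NumberField F] in
/-- Components of `finiteAdeleToLocal` (definitional). [folklore] -/
@[simp] theorem finiteAdeleToLocal_apply (v : HeightOneSpectrum (𝓞 F)) (x : FiniteAdeleRing (𝓞 E) E)
    (w : PlacesOver E v) : finiteAdeleToLocal E v x w = x w.1 := rfl

omit [NumberField F] in
/-- `𝔸_E^∞ → ∏_{w ∣ v} E_w` is continuous. [folklore] -/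
theorem continuous_finiteAdeleToLocal (v : HeightOneSpectrum (𝓞 F)) : Continuous (finiteAdeleToLocal E v) :=
  continuous_pi fun w => AdelicGroupData.continuous_finiteAdeleEval E w.1

omit [NumberField F] in
/-- `𝔸_E^∞ → ∏_{w ∣ v} E_w` on principal adeles. [folklore] -/
@[simp] theorem finiteAdeleToLocal_algebraMap (v : HeightOneSpectrum (𝓞 F)) (e : E) :
    finiteAdeleToLocal E v (algebraMap E (FiniteAdeleRing (𝓞 E) E) e) = algebraMap E (LocalRing E v) e :=
  funext fun w => FiniteAdeleRing.algebraMap_apply (𝓞 E) E e w.1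

/-- **The base change `𝔸_F^∞ → 𝔸_E^∞` at a place above `v` is `ι_w`**: `(BC x)_w = ι_w (x_v)` for `w ∣ v`
(the tree's `FiniteAdeleRing.baseChange`, componentwise `adicCompletionOfUnder`). [folklore] -/
theorem baseChange_apply_placesOver (x : FiniteAdeleRing (𝓞 F) F) {v : HeightOneSpectrum (𝓞 F)}
    (w : PlacesOver E v) :
    FiniteAdeleRing.baseChange (𝓞 F) F E (𝓞 E) x w.1 = toPlace v w (x v) := by
  obtain ⟨w, hw⟩ := w
  subst hw
  rfl

/-- `(BC a)|_{w ∣ v} = ι_v (a_v)`. [folklore] -/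
@[simp] theorem finiteAdeleToLocal_baseChange (v : HeightOneSpectrum (𝓞 F)) (a : FiniteAdeleRing (𝓞 F) F) :
    finiteAdeleToLocal E v (FiniteAdeleRing.baseChange (𝓞 F) F E (𝓞 E) a) = toLocalRing E v (a v) :=
  funext fun w => baseChange_apply_placesOver E a w

variable {E} in
/-- **Integrality transfer along `ι_w`**: `ι_w y ∈ 𝒪_w ↔ y ∈ 𝒪_v` (`v_w ∘ ι_w = v_v^{e}`, `e = e(w|v) ≥ 1`). [folklore] -/
theorem toPlace_mem_adicCompletionIntegers_iff {v : HeightOneSpectrum (𝓞 F)} (w : PlacesOver E v)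
    (y : v.adicCompletion F) :
    toPlace v w y ∈ w.1.adicCompletionIntegers E ↔ y ∈ v.adicCompletionIntegers F := by
  haveI := PlacesOver.liesOver w
  rw [HeightOneSpectrum.mem_adicCompletionIntegers, HeightOneSpectrum.mem_adicCompletionIntegers, valued_toPlace]
  exact pow_le_one_iff (Ideal.IsDedekindDomain.ramificationIdx'_ne_zero_of_liesOver w.1.asIdeal v.ne_bot)

variable {E} in
/-- `v_w(ι_w y) ≤ 1 ↔ v_v(y) ≤ 1` (valuation form of `toPlace_mem_adicCompletionIntegers_iff`). [folklore] -/
theorem valued_toPlace_le_one_iff {v : HeightOneSpectrum (𝓞 F)} (w : PlacesOver E v) (y : v.adicCompletion F) :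
    Valued.v (toPlace v w y) ≤ 1 ↔ Valued.v y ≤ 1 := by
  rw [← HeightOneSpectrum.mem_adicCompletionIntegers, ← HeightOneSpectrum.mem_adicCompletionIntegers]
  exact toPlace_mem_adicCompletionIntegers_iff w y

omit [NumberField F] [NumberField E] in
/-- A property holding at all but finitely many places of `E` holds, for all but finitely many places `v` of
`F`, at every place above `v` (`w ↦ w ∩ 𝓞_F` has finite fibres is not even needed: the exceptional `v` lie
in the image of the exceptional `w`). [folklore] -/
theorem eventually_forall_placesOver {Q : HeightOneSpectrum (𝓞 E) → Prop} (h : ∀ᶠ w in cofinite, Q w) :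
    ∀ᶠ v : HeightOneSpectrum (𝓞 F) in cofinite, ∀ w : PlacesOver E v, Q w.1 := by
  rw [Filter.eventually_cofinite] at h ⊢
  refine (h.image fun w => w.under (𝓞 F)).subset fun v hv => ?_
  simp only [Set.mem_setOf_eq, not_forall] at hv
  obtain ⟨w, hw⟩ := hv
  exact ⟨w.1, hw, w.2⟩

/-- A nonzero `e ∈ E` is a unit at all but finitely many places: `v_w(e) = 1`. [folklore] -/
theorem eventually_valued_algebraMap_eq_one {e : E} (he : e ≠ 0) :
    ∀ᶠ w : HeightOneSpectrum (𝓞 E) in cofinite, Valued.v (algebraMap E (w.adicCompletion E) e) = 1 :=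
  (FiniteAdeleRing.isUnit_iff.mp ((IsUnit.mk0 e he).map (algebraMap E (FiniteAdeleRing (𝓞 E) E)))).2

end FiniteAdeleLocal

/-! ## 2. The quadratic case, finite adeles: `𝔸_E^∞ = 𝔸_F^∞ ⊕ 𝔸_F^∞ δ` -/

section QuadraticFiniteAdele

variable (F) in
/-- The map `Ψ^∞ : 𝔸_F^∞ × 𝔸_F^∞ → 𝔸_E^∞`, `(a, b) ↦ BC a + BC b · δ` (`F` explicit: it is not determined by
`E` and `δ`). [folklore] -/
def quadraticFiniteAdeleMap (δ : E) :
    (FiniteAdeleRing (𝓞 F) F × FiniteAdeleRing (𝓞 F) F) →+ FiniteAdeleRing (𝓞 E) E where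
  toFun p := FiniteAdeleRing.baseChange (𝓞 F) F E (𝓞 E) p.1 +
    FiniteAdeleRing.baseChange (𝓞 F) F E (𝓞 E) p.2 * algebraMap E (FiniteAdeleRing (𝓞 E) E) δ
  map_zero' := by simp only [Prod.fst_zero, Prod.snd_zero, map_zero, zero_mul, add_zero]
  map_add' p q := by
    simp only [Prod.fst_add, Prod.snd_add, map_add]
    ring

/-- `Ψ^∞ (a, b) = BC a + BC b · δ` (definitional). [folklore] -/
theorem quadraticFiniteAdeleMap_apply (δ : E) (p : FiniteAdeleRing (𝓞 F) F × FiniteAdeleRing (𝓞 F) F) :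
    quadraticFiniteAdeleMap F E δ p = FiniteAdeleRing.baseChange (𝓞 F) F E (𝓞 E) p.1 +
      FiniteAdeleRing.baseChange (𝓞 F) F E (𝓞 E) p.2 * algebraMap E (FiniteAdeleRing (𝓞 E) E) δ := rfl

/-- **`Ψ^∞` is `Ψ_v` at the places above `v`**: `Ψ^∞(a, b)|_{w ∣ v} = Ψ_v (a_v, b_v)`. [folklore] -/
theorem finiteAdeleToLocal_quadraticFiniteAdeleMap (δ : E) (p : FiniteAdeleRing (𝓞 F) F × FiniteAdeleRing (𝓞 F) F)
    (v : HeightOneSpectrum (𝓞 F)) :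
    finiteAdeleToLocal E v (quadraticFiniteAdeleMap F E δ p) = quadraticLocalMap E v δ (p.1 v, p.2 v) := by
  rw [quadraticFiniteAdeleMap_apply, map_add, map_mul, finiteAdeleToLocal_baseChange, finiteAdeleToLocal_baseChange,
    finiteAdeleToLocal_algebraMap, quadraticLocalMap_apply]

/-- `Ψ^∞` is `𝔸_F^∞`-semilinear along `BC`: `Ψ^∞ (c • p) = BC c · Ψ^∞ p`. [folklore] -/
theorem quadraticFiniteAdeleMap_smul (δ : E) (c : FiniteAdeleRing (𝓞 F) F)
    (p : FiniteAdeleRing (𝓞 F) F × FiniteAdeleRing (𝓞 F) F) :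
    quadraticFiniteAdeleMap F E δ (c • p) =
      FiniteAdeleRing.baseChange (𝓞 F) F E (𝓞 E) c * quadraticFiniteAdeleMap F E δ p := by
  rw [quadraticFiniteAdeleMap_apply, quadraticFiniteAdeleMap_apply, Prod.smul_fst, Prod.smul_snd, smul_eq_mul,
    smul_eq_mul, map_mul, map_mul]
  ring

/-- `Ψ^∞` on principal adeles: `Ψ^∞ (x, y) = (x + y δ)` for `x, y ∈ F`. [folklore] -/
theorem quadraticFiniteAdeleMap_algebraMap (δ : E) (x y : F) :
    quadraticFiniteAdeleMap F E δ (algebraMap F (FiniteAdeleRing (𝓞 F) F) x, algebraMap F (FiniteAdeleRing (𝓞 F) F) y) =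
      algebraMap E (FiniteAdeleRing (𝓞 E) E) (algebraMap F E x + algebraMap F E y * δ) := by
  rw [quadraticFiniteAdeleMap_apply, FiniteAdeleRing.baseChange_algebraMap, FiniteAdeleRing.baseChange_algebraMap,
    map_add, map_mul]

/-- The multiplication by `δ` in the coordinates `(a, b)`: `δ · Ψ^∞(a, b) = Ψ^∞(d b, a)` for `δ² = d ∈ F`. [folklore] -/
theorem algebraMap_mul_quadraticFiniteAdeleMap {δ : E} {d : F} (hd : δ * δ = algebraMap F E d)
    (a b : FiniteAdeleRing (𝓞 F) F) :
    algebraMap E (FiniteAdeleRing (𝓞 E) E) δ * quadraticFiniteAdeleMap F E δ (a, b) =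
      quadraticFiniteAdeleMap F E δ (algebraMap F (FiniteAdeleRing (𝓞 F) F) d * b, a) := by
  rw [quadraticFiniteAdeleMap_apply, quadraticFiniteAdeleMap_apply]
  dsimp only
  rw [map_mul (FiniteAdeleRing.baseChange (𝓞 F) F E (𝓞 E)), FiniteAdeleRing.baseChange_algebraMap, ← hd,
    map_mul (algebraMap E (FiniteAdeleRing (𝓞 E) E))]
  ring

/-- **Injectivity of `Ψ^∞`** (from the local injectivity at every `v`). [folklore] -/
theorem quadraticFiniteAdeleMap_injective (σ : E ≃ₐ[F] E) {δ : E} (hσδ : σ δ = -δ) (hδ : δ ≠ 0) :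
    Function.Injective (quadraticFiniteAdeleMap F E δ) := by
  rw [injective_iff_map_eq_zero]
  rintro ⟨a, b⟩ h
  have hv : ∀ v : HeightOneSpectrum (𝓞 F), (a v, b v) = 0 := fun v =>
    quadraticLocalMap_injective E v σ hσδ hδ (by
      have h' := finiteAdeleToLocal_quadraticFiniteAdeleMap E δ (a, b) v
      rw [h, map_zero] at h'
      rw [map_zero]
      exact h'.symm)
  refine Prod.ext (FiniteAdeleRing.ext F fun v => ?_) (FiniteAdeleRing.ext F fun v => ?_)
  · exact (Prod.mk_eq_zero.mp (hv v)).1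
  · exact (Prod.mk_eq_zero.mp (hv v)).2

variable {E} in
/-- **Integrality of the coordinates at a good place.** If `v ∤ 2`, `δ` is a unit at every `w ∣ v`, and
`x = ι_v a + ι_v b · δ ∈ ∏_{w ∣ v} 𝒪_w`, then `a, b ∈ 𝒪_v`: apply `σ ⊗ 1` (which preserves `∏ 𝒪_w`) to get
`ι_v(2a) = x + (σ ⊗ 1) x` and `ι_v(2b) · δ = x - (σ ⊗ 1) x` integral. [folklore] -/
theorem coords_mem_adicCompletionIntegers (v : HeightOneSpectrum (𝓞 F)) (σ : E ≃ₐ[F] E) {δ : E} (hσδ : σ δ = -δ)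
    {a b : v.adicCompletion F} (h2 : Valued.v ((2 : F) : v.adicCompletion F) = 1)
    (hδw : ∀ w : PlacesOver E v, Valued.v (algebraMap E (w.1.adicCompletion E) δ) = 1)
    (hx : ∀ w : PlacesOver E v,
      (toLocalRing E v a + toLocalRing E v b * algebraMap E (LocalRing E v) δ) w ∈ w.1.adicCompletionIntegers E) :
    a ∈ v.adicCompletionIntegers F ∧ b ∈ v.adicCompletionIntegers F := by
  obtain ⟨w₀⟩ := PlacesOver.nonempty E v
  have hconj : conjLocal E σ v (toLocalRing E v a + toLocalRing E v b * algebraMap E (LocalRing E v) δ) =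
      toLocalRing E v a - toLocalRing E v b * algebraMap E (LocalRing E v) δ := by
    rw [map_add, map_mul, conjLocal_toLocalRing, conjLocal_toLocalRing, conjLocal_algebraMap, hσδ, map_neg]
    ring
  have hcx : ∀ w : PlacesOver E v, conjLocal E σ v
      (toLocalRing E v a + toLocalRing E v b * algebraMap E (LocalRing E v) δ) w ∈ w.1.adicCompletionIntegers E :=
    fun w => by
    rw [conjLocal_apply]
    exact (galAdicCompletionMap_mem_adicCompletionIntegers_iff E σ _ _).mpr (hx ⟨σ⁻¹ • w.1, under_inv_smul_eq σ w⟩)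
  have hxw₀ : (toLocalRing E v a + toLocalRing E v b * algebraMap E (LocalRing E v) δ) w₀ =
      toPlace v w₀ a + toPlace v w₀ b * algebraMap E (w₀.1.adicCompletion E) δ := rfl
  have hcw₀ : conjLocal E σ v (toLocalRing E v a + toLocalRing E v b * algebraMap E (LocalRing E v) δ) w₀ =
      toPlace v w₀ a - toPlace v w₀ b * algebraMap E (w₀.1.adicCompletion E) δ := by
    rw [hconj]; rfl
  -- `(2 : F)` in `F_v` is `2`, so `v(y + y) = v(y)` at this place
  have h2cast : ((2 : F) : v.adicCompletion F) = 2 := by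
    have h := map_ofNat (algebraMap F (v.adicCompletion F)) 2
    rw [HeightOneSpectrum.algebraMap_adicCompletion, Function.comp_apply, Algebra.algebraMap_self, RingHom.id_apply] at h
    exact h
  have hvv : ∀ y : v.adicCompletion F, Valued.v (y + y) = Valued.v y := fun y => by
    rw [← two_mul, ← h2cast, map_mul, h2, one_mul]
  -- `a`: `x + σx = ι(a + a)`
  have ha : a ∈ v.adicCompletionIntegers F := by
    have hmem : toPlace v w₀ (a + a) ∈ w₀.1.adicCompletionIntegers E := by
      have : (toLocalRing E v a + toLocalRing E v b * algebraMap E (LocalRing E v) δ) w₀ + conjLocal E σ v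
          (toLocalRing E v a + toLocalRing E v b * algebraMap E (LocalRing E v) δ) w₀ = toPlace v w₀ (a + a) := by
        rw [hxw₀, hcw₀, map_add]; ring
      rw [← this]; exact add_mem (hx w₀) (hcx w₀)
    rw [toPlace_mem_adicCompletionIntegers_iff, HeightOneSpectrum.mem_adicCompletionIntegers, hvv] at hmem
    exact (HeightOneSpectrum.mem_adicCompletionIntegers _ _ _).mpr hmem
  -- `b`: `x - σx = ι(b + b) δ`
  have hb : b ∈ v.adicCompletionIntegers F := by
    have hmem : toPlace v w₀ (b + b) * algebraMap E (w₀.1.adicCompletion E) δ ∈ w₀.1.adicCompletionIntegers E := by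
      have : (toLocalRing E v a + toLocalRing E v b * algebraMap E (LocalRing E v) δ) w₀ - conjLocal E σ v
          (toLocalRing E v a + toLocalRing E v b * algebraMap E (LocalRing E v) δ) w₀ =
            toPlace v w₀ (b + b) * algebraMap E (w₀.1.adicCompletion E) δ := by
        rw [hxw₀, hcw₀, map_add]; ring
      rw [← this]; exact sub_mem (hx w₀) (hcx w₀)
    rw [HeightOneSpectrum.mem_adicCompletionIntegers, map_mul, hδw w₀, mul_one, valued_toPlace_le_one_iff, hvv] at hmem
    exact (HeightOneSpectrum.mem_adicCompletionIntegers _ _ _).mpr hmem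
  exact ⟨ha, hb⟩

/-- **Surjectivity of `Ψ^∞`** for a quadratic extension: the local coordinates `(a_v, b_v) = Ψ_v⁻¹ (y|_{w ∣ v})`
are integral at all but finitely many `v` (`coords_mem_adicCompletionIntegers` at the `v ∤ 2` above which `y` and
`δ^{±1}` are integral), so they form finite adeles `a, b` with `Ψ^∞(a, b) = y`. [folklore] -/
theorem quadraticFiniteAdeleMap_surjective [Algebra.IsQuadraticExtension F E] (σ : E ≃ₐ[F] E) {δ : E}
    (hσδ : σ δ = -δ) (hδ : δ ≠ 0) : Function.Surjective (quadraticFiniteAdeleMap F E δ) := by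
  intro y
  -- local coordinates
  let a₀ : (v : HeightOneSpectrum (𝓞 F)) → v.adicCompletion F := fun v =>
    ((quadraticLocalEquiv E v σ hσδ hδ).symm (finiteAdeleToLocal E v y)).1
  let b₀ : (v : HeightOneSpectrum (𝓞 F)) → v.adicCompletion F := fun v =>
    ((quadraticLocalEquiv E v σ hσδ hδ).symm (finiteAdeleToLocal E v y)).2
  have hab : ∀ v : HeightOneSpectrum (𝓞 F),
      toLocalRing E v (a₀ v) + toLocalRing E v (b₀ v) * algebraMap E (LocalRing E v) δ = finiteAdeleToLocal E v y := by
    intro v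
    rw [← quadraticLocalEquiv_apply E v σ hσδ hδ]
    exact (quadraticLocalEquiv E v σ hσδ hδ).apply_symm_apply _
  -- almost-everywhere integrality of the coordinates
  have h2 : ∀ᶠ v : HeightOneSpectrum (𝓞 F) in cofinite, Valued.v ((2 : F) : v.adicCompletion F) = 1 :=
    (FiniteAdeleRing.isUnit_iff.mp
      ((IsUnit.mk0 (2 : F) two_ne_zero).map (algebraMap F (FiniteAdeleRing (𝓞 F) F)))).2
  have hδ' : ∀ᶠ v : HeightOneSpectrum (𝓞 F) in cofinite,
      ∀ w : PlacesOver E v, Valued.v (algebraMap E (w.1.adicCompletion E) δ) = 1 :=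
    eventually_forall_placesOver E (eventually_valued_algebraMap_eq_one E hδ)
  have hy : ∀ᶠ v : HeightOneSpectrum (𝓞 F) in cofinite,
      ∀ w : PlacesOver E v, y w.1 ∈ w.1.adicCompletionIntegers E :=
    eventually_forall_placesOver E (Q := fun w => y w ∈ w.adicCompletionIntegers E) y.2
  have hint : ∀ᶠ v : HeightOneSpectrum (𝓞 F) in cofinite,
      a₀ v ∈ v.adicCompletionIntegers F ∧ b₀ v ∈ v.adicCompletionIntegers F :=
    (h2.and (hδ'.and hy)).mono fun v hv =>
      coords_mem_adicCompletionIntegers v σ hσδ hv.1 hv.2.1 fun w => by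
        rw [hab v, finiteAdeleToLocal_apply]
        exact hv.2.2 w
  refine ⟨(RestrictedProduct.mk a₀ (hint.mono fun v hv => hv.1), RestrictedProduct.mk b₀ (hint.mono fun v hv => hv.2)),
    FiniteAdeleRing.ext E fun w => ?_⟩
  change finiteAdeleToLocal E (w.under (𝓞 F)) (quadraticFiniteAdeleMap F E δ _) ⟨w, rfl⟩ =
    finiteAdeleToLocal E (w.under (𝓞 F)) y ⟨w, rfl⟩
  rw [finiteAdeleToLocal_quadraticFiniteAdeleMap, quadraticLocalMap_apply]
  dsimp only
  rw [← hab (w.under (𝓞 F))]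
  rfl

variable (F) in
/-- **`𝔸_E^∞ = 𝔸_F^∞ ⊕ 𝔸_F^∞ δ`**: for a quadratic extension `E/F` of number fields, `σ ∈ Aut(E/F)` and
`δ ∈ E` with `σ δ = -δ ≠ 0`, the map `(a, b) ↦ BC a + BC b · δ` is an additive isomorphism
`𝔸_F^∞ × 𝔸_F^∞ ≃ 𝔸_E^∞`, `𝔸_F^∞`-semilinear along `BC` (`quadraticFiniteAdeleMap_smul`) — the finite part of
`𝔸_E = 𝔸_F ⊗_F E` (Cassels–Fröhlich II §14) in the basis `(1, δ)`. [cite: CasselsFrohlichANT1967, Ch. II §14] -/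
def quadraticFiniteAdeleEquiv [Algebra.IsQuadraticExtension F E] (σ : E ≃ₐ[F] E) {δ : E} (hσδ : σ δ = -δ)
    (hδ : δ ≠ 0) : (FiniteAdeleRing (𝓞 F) F × FiniteAdeleRing (𝓞 F) F) ≃+ FiniteAdeleRing (𝓞 E) E :=
  AddEquiv.ofBijective (quadraticFiniteAdeleMap F E δ)
    ⟨quadraticFiniteAdeleMap_injective E σ hσδ hδ, quadraticFiniteAdeleMap_surjective E σ hσδ hδ⟩

/-- `quadraticFiniteAdeleEquiv` is `Ψ^∞`. [folklore] -/
@[simp] theorem quadraticFiniteAdeleEquiv_apply [Algebra.IsQuadraticExtension F E] (σ : E ≃ₐ[F] E) {δ : E}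
    (hσδ : σ δ = -δ) (hδ : δ ≠ 0) (p : FiniteAdeleRing (𝓞 F) F × FiniteAdeleRing (𝓞 F) F) :
    quadraticFiniteAdeleEquiv F E σ hσδ hδ p = FiniteAdeleRing.baseChange (𝓞 F) F E (𝓞 E) p.1 +
      FiniteAdeleRing.baseChange (𝓞 F) F E (𝓞 E) p.2 * algebraMap E (FiniteAdeleRing (𝓞 E) E) δ := rfl

/-- Every finite adele of `E` is uniquely `BC a + BC b · δ`. [folklore] -/
theorem existsUnique_eq_baseChange_add [Algebra.IsQuadraticExtension F E] (σ : E ≃ₐ[F] E) {δ : E}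
    (hσδ : σ δ = -δ) (hδ : δ ≠ 0) (y : FiniteAdeleRing (𝓞 E) E) :
    ∃! p : FiniteAdeleRing (𝓞 F) F × FiniteAdeleRing (𝓞 F) F,
      y = FiniteAdeleRing.baseChange (𝓞 F) F E (𝓞 E) p.1 +
        FiniteAdeleRing.baseChange (𝓞 F) F E (𝓞 E) p.2 * algebraMap E (FiniteAdeleRing (𝓞 E) E) δ := by
  refine ⟨(quadraticFiniteAdeleEquiv F E σ hσδ hδ).symm y, ?_, fun p hp => ?_⟩
  · change y = _
    rw [← quadraticFiniteAdeleEquiv_apply E σ hσδ hδ, AddEquiv.apply_symm_apply]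
  · change y = _ at hp
    rw [← quadraticFiniteAdeleEquiv_apply E σ hσδ hδ] at hp
    rw [hp, AddEquiv.symm_apply_apply]

variable (F) in
/-- `Ψ^∞` is continuous. [folklore] -/
theorem continuous_quadraticFiniteAdeleMap (δ : E) : Continuous (quadraticFiniteAdeleMap F E δ) :=
  ((FiniteAdeleRing.continuous_baseChange (𝓞 F) F E (𝓞 E)).comp continuous_fst).add
    (((FiniteAdeleRing.continuous_baseChange (𝓞 F) F E (𝓞 E)).comp continuous_snd).mul continuous_const)

/-- The local coordinates of `Ψ^∞⁻¹`: `(Ψ^∞⁻¹ y)_v = Ψ_v⁻¹ (y|_{w ∣ v})`. [folklore] -/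
theorem quadraticFiniteAdeleEquiv_symm_apply_local [Algebra.IsQuadraticExtension F E] (σ : E ≃ₐ[F] E) {δ : E}
    (hσδ : σ δ = -δ) (hδ : δ ≠ 0) (y : FiniteAdeleRing (𝓞 E) E) (v : HeightOneSpectrum (𝓞 F)) :
    (((quadraticFiniteAdeleEquiv F E σ hσδ hδ).symm y).1 v, ((quadraticFiniteAdeleEquiv F E σ hσδ hδ).symm y).2 v) =
      (quadraticLocalEquiv E v σ hσδ hδ).symm (finiteAdeleToLocal E v y) := by
  rw [eq_comm, ContinuousLinearEquiv.symm_apply_eq]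
  symm
  change quadraticLocalMap E v δ _ = _
  rw [← finiteAdeleToLocal_quadraticFiniteAdeleMap]
  change finiteAdeleToLocal E v (quadraticFiniteAdeleEquiv F E σ hσδ hδ ((quadraticFiniteAdeleEquiv F E σ hσδ hδ).symm y)) = _
  rw [AddEquiv.apply_symm_apply]

end QuadraticFiniteAdele

/-! ## 3. `Ψ^∞` is a homeomorphism: `𝔸_F^∞ × 𝔸_F^∞ ≃ₜ+ 𝔸_E^∞` -/

section QuadraticFiniteAdeleTopology

open RestrictedProduct in
/-- **Continuity of `Ψ^∞⁻¹`.** On the part of `𝔸_E^∞` integral outside a finite set `Sᶜ` of places (these parts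
carry the product topology and exhaust the restricted product topologically, Mathlib
`RestrictedProduct.continuous_dom`), the coordinates `(a_v, b_v) = Ψ_v⁻¹(y|_{w ∣ v})` are continuous in `y`
(`quadraticLocalEquiv` is bicontinuous) and integral at every `v` in a cofinite set `T` (`v ∤ 2`, `δ` a unit above
`v`, all `w ∣ v` in `S`; `coords_mem_adicCompletionIntegers`), so `Ψ^∞⁻¹` factors continuously through
`𝔸_{F,T}^∞ × 𝔸_{F,T}^∞`. [folklore] -/
theorem continuous_quadraticFiniteAdeleEquiv_symm [Algebra.IsQuadraticExtension F E] (σ : E ≃ₐ[F] E) {δ : E}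
    (hσδ : σ δ = -δ) (hδ : δ ≠ 0) : Continuous (quadraticFiniteAdeleEquiv F E σ hσδ hδ).symm := by
  set Ψ := quadraticFiniteAdeleEquiv F E σ hσδ hδ with hΨ
  refine (RestrictedProduct.continuous_dom (R := fun w : HeightOneSpectrum (𝓞 E) => w.adicCompletion E)
    (A := fun w : HeightOneSpectrum (𝓞 E) => (w.adicCompletionIntegers E : Set (w.adicCompletion E)))
    (𝓕 := cofinite) (f := fun y : FiniteAdeleRing (𝓞 E) E => Ψ.symm y)).mpr fun S hS => ?_
  -- the cofinite set `T` of good places of `F`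
  have h2 : ∀ᶠ v : HeightOneSpectrum (𝓞 F) in cofinite, Valued.v ((2 : F) : v.adicCompletion F) = 1 :=
    (FiniteAdeleRing.isUnit_iff.mp
      ((IsUnit.mk0 (2 : F) two_ne_zero).map (algebraMap F (FiniteAdeleRing (𝓞 F) F)))).2
  have hδ' : ∀ᶠ v : HeightOneSpectrum (𝓞 F) in cofinite,
      ∀ w : PlacesOver E v, Valued.v (algebraMap E (w.1.adicCompletion E) δ) = 1 :=
    eventually_forall_placesOver E (eventually_valued_algebraMap_eq_one E hδ)
  have hS' : ∀ᶠ v : HeightOneSpectrum (𝓞 F) in cofinite, ∀ w : PlacesOver E v, w.1 ∈ S :=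
    eventually_forall_placesOver E (Q := fun w => w ∈ S) (Filter.eventually_mem_set.mpr (Filter.le_principal_iff.mp hS))
  set T : Set (HeightOneSpectrum (𝓞 F)) := {v | Valued.v ((2 : F) : v.adicCompletion F) = 1 ∧
      (∀ w : PlacesOver E v, Valued.v (algebraMap E (w.1.adicCompletion E) δ) = 1) ∧ ∀ w : PlacesOver E v, w.1 ∈ S}
    with hT_def
  have hT : (cofinite : Filter (HeightOneSpectrum (𝓞 F))) ≤ 𝓟 T :=
    Filter.le_principal_iff.mpr (h2.and (hδ'.and hS'))
  -- the `S`-principal part of `𝔸_E^∞` and its local coordinates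
  let cS : Πʳ w : HeightOneSpectrum (𝓞 E), [w.adicCompletion E, (w.adicCompletionIntegers E : Set (w.adicCompletion E))]_[𝓟 S] →
      FiniteAdeleRing (𝓞 E) E := RestrictedProduct.inclusion _ _ hS
  let locS : (v : HeightOneSpectrum (𝓞 F)) →
      (Πʳ w : HeightOneSpectrum (𝓞 E), [w.adicCompletion E, (w.adicCompletionIntegers E : Set (w.adicCompletion E))]_[𝓟 S]) →
        LocalRing E v := fun v y => finiteAdeleToLocal E v (cS y)
  have hloc : ∀ v, Continuous (locS v) := fun v =>
    continuous_pi fun w : PlacesOver E v => RestrictedProduct.continuous_eval w.1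
  let cA : (v : HeightOneSpectrum (𝓞 F)) →
      (Πʳ w : HeightOneSpectrum (𝓞 E), [w.adicCompletion E, (w.adicCompletionIntegers E : Set (w.adicCompletion E))]_[𝓟 S]) →
        v.adicCompletion F := fun v y => ((quadraticLocalEquiv E v σ hσδ hδ).symm (locS v y)).1
  let cB : (v : HeightOneSpectrum (𝓞 F)) →
      (Πʳ w : HeightOneSpectrum (𝓞 E), [w.adicCompletion E, (w.adicCompletionIntegers E : Set (w.adicCompletion E))]_[𝓟 S]) →
        v.adicCompletion F := fun v y => ((quadraticLocalEquiv E v σ hσδ hδ).symm (locS v y)).2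
  have hA : ∀ v, Continuous (cA v) := fun v =>
    continuous_fst.comp ((quadraticLocalEquiv E v σ hσδ hδ).symm.continuous.comp (hloc v))
  have hB : ∀ v, Continuous (cB v) := fun v =>
    continuous_snd.comp ((quadraticLocalEquiv E v σ hσδ hδ).symm.continuous.comp (hloc v))
  -- integrality of the coordinates on `T`
  have hAB : ∀ y, ∀ v ∈ T, cA v y ∈ v.adicCompletionIntegers F ∧ cB v y ∈ v.adicCompletionIntegers F := by
    intro y v hv
    refine coords_mem_adicCompletionIntegers v σ hσδ hv.1 hv.2.1 fun w => ?_
    have hrec : toLocalRing E v (cA v y) + toLocalRing E v (cB v y) * algebraMap E (LocalRing E v) δ = locS v y := by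
      rw [← quadraticLocalEquiv_apply E v σ hσδ hδ]
      exact (quadraticLocalEquiv E v σ hσδ hδ).apply_symm_apply _
    rw [hrec]
    exact Filter.eventually_principal.mp y.2 w.1 (hv.2.2 w)
  -- the continuous factorisation through `𝔸_{F,T}^∞ × 𝔸_{F,T}^∞`
  let g : (Πʳ w : HeightOneSpectrum (𝓞 E), [w.adicCompletion E, (w.adicCompletionIntegers E : Set (w.adicCompletion E))]_[𝓟 S]) →
      (Πʳ v : HeightOneSpectrum (𝓞 F), [v.adicCompletion F, (v.adicCompletionIntegers F : Set (v.adicCompletion F))]_[𝓟 T]) ×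
        (Πʳ v : HeightOneSpectrum (𝓞 F), [v.adicCompletion F, (v.adicCompletionIntegers F : Set (v.adicCompletion F))]_[𝓟 T]) :=
    fun y => (⟨fun v => cA v y, Filter.eventually_principal.mpr fun v hv => (hAB y v hv).1⟩,
      ⟨fun v => cB v y, Filter.eventually_principal.mpr fun v hv => (hAB y v hv).2⟩)
  have hg : Continuous g :=
    (RestrictedProduct.continuous_rng_of_principal.mpr (continuous_pi fun v => hA v)).prodMk
      (RestrictedProduct.continuous_rng_of_principal.mpr (continuous_pi fun v => hB v))
  have hfac : (fun y => Ψ.symm y) ∘ cS = fun y =>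
      ((RestrictedProduct.inclusion _ _ hT (g y).1 : FiniteAdeleRing (𝓞 F) F),
        (RestrictedProduct.inclusion _ _ hT (g y).2 : FiniteAdeleRing (𝓞 F) F)) := by
    funext y
    have key := fun v => quadraticFiniteAdeleEquiv_symm_apply_local E σ hσδ hδ (cS y) v
    refine Prod.ext (FiniteAdeleRing.ext F fun v => ?_) (FiniteAdeleRing.ext F fun v => ?_)
    · exact (Prod.ext_iff.mp (key v)).1
    · exact (Prod.ext_iff.mp (key v)).2
  show Continuous ((fun y => Ψ.symm y) ∘ cS)
  rw [hfac]
  exact ((RestrictedProduct.continuous_inclusion hT).comp (continuous_fst.comp hg)).prodMk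
    ((RestrictedProduct.continuous_inclusion hT).comp (continuous_snd.comp hg))

variable (F) in
/-- **`𝔸_F^∞ × 𝔸_F^∞ ≃ₜ+ 𝔸_E^∞`**: `Ψ^∞` as an isomorphism of topological groups (quadratic `E/F`).
[cite: CasselsFrohlichANT1967, Ch. II §14] -/
def quadraticFiniteAdeleContinuousEquiv [Algebra.IsQuadraticExtension F E] (σ : E ≃ₐ[F] E) {δ : E}
    (hσδ : σ δ = -δ) (hδ : δ ≠ 0) :
    (FiniteAdeleRing (𝓞 F) F × FiniteAdeleRing (𝓞 F) F) ≃ₜ+ FiniteAdeleRing (𝓞 E) E :=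
  { quadraticFiniteAdeleEquiv F E σ hσδ hδ with
    continuous_toFun := continuous_quadraticFiniteAdeleMap F E δ
    continuous_invFun := continuous_quadraticFiniteAdeleEquiv_symm E σ hσδ hδ }

/-- `quadraticFiniteAdeleContinuousEquiv` is `Ψ^∞`. [folklore] -/
@[simp] theorem quadraticFiniteAdeleContinuousEquiv_apply [Algebra.IsQuadraticExtension F E] (σ : E ≃ₐ[F] E)
    {δ : E} (hσδ : σ δ = -δ) (hδ : δ ≠ 0) (p : FiniteAdeleRing (𝓞 F) F × FiniteAdeleRing (𝓞 F) F) :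
    quadraticFiniteAdeleContinuousEquiv F E σ hσδ hδ p = FiniteAdeleRing.baseChange (𝓞 F) F E (𝓞 E) p.1 +
      FiniteAdeleRing.baseChange (𝓞 F) F E (𝓞 E) p.2 * algebraMap E (FiniteAdeleRing (𝓞 E) E) δ := rfl

end QuadraticFiniteAdeleTopology

/-! ## 4. The adele ring: `𝔸_E = 𝔸_F ⊕ 𝔸_F δ`, i.e. `E ⊗_F 𝔸_F = 𝔸_E` in the basis `(1, δ)` -/

section Adele

variable (F) in
/-- **`Ψ_𝔸 : 𝔸_F × 𝔸_F → 𝔸_E`, `(a, b) ↦ (a ⊗ 1) + (b ⊗ 1) · δ`** (additive; `a ⊗ 1` is the tree's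
`AdeleRing.baseChange`, archimedean and finite parts side by side). [folklore] -/
def quadraticAdeleMap (δ : E) : (AdeleRing (𝓞 F) F × AdeleRing (𝓞 F) F) →+ AdeleRing (𝓞 E) E where
  toFun p := AdeleRing.baseChange F E p.1 + AdeleRing.baseChange F E p.2 * algebraMap E (AdeleRing (𝓞 E) E) δ
  map_zero' := by simp only [Prod.fst_zero, Prod.snd_zero, map_zero, zero_mul, add_zero]
  map_add' p q := by
    simp only [Prod.fst_add, Prod.snd_add, map_add]
    ring

/-- `Ψ_𝔸 (a, b) = (a ⊗ 1) + (b ⊗ 1) · δ` (definitional). [folklore] -/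
@[simp] theorem quadraticAdeleMap_apply (δ : E) (p : AdeleRing (𝓞 F) F × AdeleRing (𝓞 F) F) :
    quadraticAdeleMap F E δ p = AdeleRing.baseChange F E p.1 +
      AdeleRing.baseChange F E p.2 * algebraMap E (AdeleRing (𝓞 E) E) δ := rfl

/-- The archimedean part of `Ψ_𝔸` is `Ψ_∞` (definitional). [folklore] -/
theorem quadraticAdeleMap_fst (δ : E) (p : AdeleRing (𝓞 F) F × AdeleRing (𝓞 F) F) :
    (quadraticAdeleMap F E δ p).1 = quadraticInfiniteAdeleMap F E δ (p.1.1, p.2.1) := rfl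

/-- The finite part of `Ψ_𝔸` is `Ψ^∞` (definitional). [folklore] -/
theorem quadraticAdeleMap_snd (δ : E) (p : AdeleRing (𝓞 F) F × AdeleRing (𝓞 F) F) :
    (quadraticAdeleMap F E δ p).2 = quadraticFiniteAdeleMap F E δ (p.1.2, p.2.2) := rfl

/-- `Ψ_𝔸` is continuous. [folklore] -/
theorem continuous_quadraticAdeleMap (δ : E) : Continuous (quadraticAdeleMap F E δ) :=
  ((AdeleRing.continuous_baseChange F E).comp continuous_fst).add
    (((AdeleRing.continuous_baseChange F E).comp continuous_snd).mul continuous_const)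

/-- `Ψ_𝔸` is `(· ⊗ 1)`-semilinear: `Ψ_𝔸 (c a, c b) = (c ⊗ 1) Ψ_𝔸 (a, b)` — `𝔸_E` is an `𝔸_F`-module of rank `2`
through `(· ⊗ 1)` with basis `(1, δ)`. [folklore] -/
theorem quadraticAdeleMap_smul (δ : E) (c : AdeleRing (𝓞 F) F) (p : AdeleRing (𝓞 F) F × AdeleRing (𝓞 F) F) :
    quadraticAdeleMap F E δ (c • p) = AdeleRing.baseChange F E c * quadraticAdeleMap F E δ p := by
  rw [quadraticAdeleMap_apply, quadraticAdeleMap_apply, Prod.smul_fst, Prod.smul_snd, smul_eq_mul, smul_eq_mul,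
    map_mul, map_mul]
  ring

/-- `Ψ_𝔸` on the diagonal image of `E = F ⊕ F δ`: `Ψ_𝔸 (x, y) = x + y δ` for `x, y ∈ F`. [folklore] -/
theorem quadraticAdeleMap_algebraMap (δ : E) (x y : F) :
    quadraticAdeleMap F E δ (algebraMap F (AdeleRing (𝓞 F) F) x, algebraMap F (AdeleRing (𝓞 F) F) y) =
      algebraMap E (AdeleRing (𝓞 E) E) (algebraMap F E x + algebraMap F E y * δ) := by
  rw [quadraticAdeleMap_apply, AdeleRing.baseChange_algebraMap, AdeleRing.baseChange_algebraMap, map_add, map_mul]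

/-- **Multiplication by `δ`** in the coordinates: `δ · Ψ_𝔸 (a, b) = Ψ_𝔸 (d b, a)` for `δ² = d ∈ F`. [folklore] -/
theorem algebraMap_mul_quadraticAdeleMap {δ : E} {d : F} (hd : δ * δ = algebraMap F E d) (a b : AdeleRing (𝓞 F) F) :
    algebraMap E (AdeleRing (𝓞 E) E) δ * quadraticAdeleMap F E δ (a, b) =
      quadraticAdeleMap F E δ (algebraMap F (AdeleRing (𝓞 F) F) d * b, a) := by
  rw [quadraticAdeleMap_apply, quadraticAdeleMap_apply]
  dsimp only
  rw [map_mul (AdeleRing.baseChange F E), AdeleRing.baseChange_algebraMap, ← hd,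
    map_mul (algebraMap E (AdeleRing (𝓞 E) E))]
  ring

/-- **Injectivity of `Ψ_𝔸`** (archimedean and finite parts). [folklore] -/
theorem quadraticAdeleMap_injective [Algebra.IsQuadraticExtension F E] (σ : E ≃ₐ[F] E) {δ : E} (hσδ : σ δ = -δ)
    (hδ : δ ≠ 0) : Function.Injective (quadraticAdeleMap F E δ) := by
  rw [injective_iff_map_eq_zero]
  intro p h
  have h1 : (p.1.1, p.2.1) = 0 :=
    quadraticInfiniteAdeleMap_injective E (not_mem_range_algebraMap_of_apply_eq_neg E σ hσδ hδ) (by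
      rw [← quadraticAdeleMap_fst, h, map_zero]; rfl)
  have h2 : (p.1.2, p.2.2) = 0 :=
    quadraticFiniteAdeleMap_injective E σ hσδ hδ (by rw [← quadraticAdeleMap_snd, h, map_zero]; rfl)
  obtain ⟨h11, h21⟩ := Prod.mk_eq_zero.mp h1
  obtain ⟨h12, h22⟩ := Prod.mk_eq_zero.mp h2
  exact Prod.ext (Prod.ext h11 h12) (Prod.ext h21 h22)

/-- The inverse of `Ψ_𝔸`, from `Ψ_∞⁻¹` and `(Ψ^∞)⁻¹`. [folklore] -/
def quadraticAdeleInv [Algebra.IsQuadraticExtension F E] (σ : E ≃ₐ[F] E) {δ : E} (hσδ : σ δ = -δ) (hδ : δ ≠ 0)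
    (y : AdeleRing (𝓞 E) E) : AdeleRing (𝓞 F) F × AdeleRing (𝓞 F) F :=
  ((((quadraticInfiniteAdeleEquiv F E (not_mem_range_algebraMap_of_apply_eq_neg E σ hσδ hδ)).symm y.1).1,
      ((quadraticFiniteAdeleContinuousEquiv F E σ hσδ hδ).symm y.2).1),
    (((quadraticInfiniteAdeleEquiv F E (not_mem_range_algebraMap_of_apply_eq_neg E σ hσδ hδ)).symm y.1).2,
      ((quadraticFiniteAdeleContinuousEquiv F E σ hσδ hδ).symm y.2).2))

/-- `Ψ_𝔸 ∘ Ψ_𝔸⁻¹ = id`. [folklore] -/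
theorem quadraticAdeleMap_inv [Algebra.IsQuadraticExtension F E] (σ : E ≃ₐ[F] E) {δ : E} (hσδ : σ δ = -δ)
    (hδ : δ ≠ 0) (y : AdeleRing (𝓞 E) E) : quadraticAdeleMap F E δ (quadraticAdeleInv E σ hσδ hδ y) = y := by
  refine Prod.ext ?_ ?_
  · rw [quadraticAdeleMap_fst]
    change quadraticInfiniteAdeleEquiv F E (not_mem_range_algebraMap_of_apply_eq_neg E σ hσδ hδ)
      ((((quadraticInfiniteAdeleEquiv F E (not_mem_range_algebraMap_of_apply_eq_neg E σ hσδ hδ)).symm y.1).1,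
        ((quadraticInfiniteAdeleEquiv F E (not_mem_range_algebraMap_of_apply_eq_neg E σ hσδ hδ)).symm y.1).2)) = y.1
    rw [Prod.mk.eta, ContinuousAddEquiv.apply_symm_apply]
  · rw [quadraticAdeleMap_snd]
    change quadraticFiniteAdeleContinuousEquiv F E σ hσδ hδ
      ((((quadraticFiniteAdeleContinuousEquiv F E σ hσδ hδ).symm y.2).1,
        ((quadraticFiniteAdeleContinuousEquiv F E σ hσδ hδ).symm y.2).2)) = y.2
    rw [Prod.mk.eta, ContinuousAddEquiv.apply_symm_apply]

/-- **Surjectivity of `Ψ_𝔸`**. [folklore] -/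
theorem quadraticAdeleMap_surjective [Algebra.IsQuadraticExtension F E] (σ : E ≃ₐ[F] E) {δ : E} (hσδ : σ δ = -δ)
    (hδ : δ ≠ 0) : Function.Surjective (quadraticAdeleMap F E δ) :=
  fun y => ⟨quadraticAdeleInv E σ hσδ hδ y, quadraticAdeleMap_inv E σ hσδ hδ y⟩

/-- `Ψ_𝔸⁻¹` is continuous. [folklore] -/
theorem continuous_quadraticAdeleInv [Algebra.IsQuadraticExtension F E] (σ : E ≃ₐ[F] E) {δ : E} (hσδ : σ δ = -δ)
    (hδ : δ ≠ 0) : Continuous (quadraticAdeleInv E σ hσδ hδ) := by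
  have hi : Continuous fun y : AdeleRing (𝓞 E) E =>
      (quadraticInfiniteAdeleEquiv F E (not_mem_range_algebraMap_of_apply_eq_neg E σ hσδ hδ)).symm y.1 :=
    (quadraticInfiniteAdeleEquiv F E _).symm.continuous.comp continuous_fst
  have hf : Continuous fun y : AdeleRing (𝓞 E) E => (quadraticFiniteAdeleContinuousEquiv F E σ hσδ hδ).symm y.2 :=
    (quadraticFiniteAdeleContinuousEquiv F E σ hσδ hδ).symm.continuous.comp continuous_snd
  exact ((continuous_fst.comp hi).prodMk (continuous_fst.comp hf)).prodMk
    ((continuous_snd.comp hi).prodMk (continuous_snd.comp hf))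

variable (F) in
/-- **`𝔸_E = 𝔸_F ⊕ 𝔸_F δ` (`E ⊗_F 𝔸_F ≅ 𝔸_E`, Cassels–Fröhlich II §14, quadratic case in the basis `(1, δ)`)**:
for a quadratic extension `E/F` of number fields, `σ ∈ Aut(E/F)` and `δ ∈ E` with `σ δ = -δ ≠ 0`, the map
`(a, b) ↦ (a ⊗ 1) + (b ⊗ 1) · δ` is an isomorphism of topological groups `𝔸_F × 𝔸_F ≃ₜ+ 𝔸_E`, semilinear
for `(· ⊗ 1) : 𝔸_F → 𝔸_E` (`quadraticAdeleMap_smul`). [cite: CasselsFrohlichANT1967, Ch. II §14] -/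
def quadraticAdeleEquiv [Algebra.IsQuadraticExtension F E] (σ : E ≃ₐ[F] E) {δ : E} (hσδ : σ δ = -δ) (hδ : δ ≠ 0) :
    (AdeleRing (𝓞 F) F × AdeleRing (𝓞 F) F) ≃ₜ+ AdeleRing (𝓞 E) E :=
  { toFun := quadraticAdeleMap F E δ
    invFun := quadraticAdeleInv E σ hσδ hδ
    left_inv := fun _ => quadraticAdeleMap_injective E σ hσδ hδ (quadraticAdeleMap_inv E σ hσδ hδ _)
    right_inv := quadraticAdeleMap_inv E σ hσδ hδ
    map_add' := map_add (quadraticAdeleMap F E δ)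
    continuous_toFun := continuous_quadraticAdeleMap E δ
    continuous_invFun := continuous_quadraticAdeleInv E σ hσδ hδ }

/-- `quadraticAdeleEquiv` is `Ψ_𝔸`. [folklore] -/
@[simp] theorem quadraticAdeleEquiv_apply [Algebra.IsQuadraticExtension F E] (σ : E ≃ₐ[F] E) {δ : E}
    (hσδ : σ δ = -δ) (hδ : δ ≠ 0) (p : AdeleRing (𝓞 F) F × AdeleRing (𝓞 F) F) :
    quadraticAdeleEquiv F E σ hσδ hδ p = AdeleRing.baseChange F E p.1 +
      AdeleRing.baseChange F E p.2 * algebraMap E (AdeleRing (𝓞 E) E) δ := rfl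

/-- The archimedean part of `Ψ_𝔸⁻¹` is `Ψ_∞⁻¹` (definitional). [folklore] -/
theorem quadraticAdeleEquiv_symm_fst [Algebra.IsQuadraticExtension F E] (σ : E ≃ₐ[F] E) {δ : E}
    (hσδ : σ δ = -δ) (hδ : δ ≠ 0) (y : AdeleRing (𝓞 E) E) :
    (((quadraticAdeleEquiv F E σ hσδ hδ).symm y).1.1, ((quadraticAdeleEquiv F E σ hσδ hδ).symm y).2.1) =
      (quadraticInfiniteAdeleEquiv F E (not_mem_range_algebraMap_of_apply_eq_neg E σ hσδ hδ)).symm y.1 :=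
  Prod.mk.eta

/-- The finite part of `Ψ_𝔸⁻¹` is `(Ψ^∞)⁻¹` (definitional). [folklore] -/
theorem quadraticAdeleEquiv_symm_snd [Algebra.IsQuadraticExtension F E] (σ : E ≃ₐ[F] E) {δ : E}
    (hσδ : σ δ = -δ) (hδ : δ ≠ 0) (y : AdeleRing (𝓞 E) E) :
    (((quadraticAdeleEquiv F E σ hσδ hδ).symm y).1.2, ((quadraticAdeleEquiv F E σ hσδ hδ).symm y).2.2) =
      (quadraticFiniteAdeleContinuousEquiv F E σ hσδ hδ).symm y.2 :=
  Prod.mk.eta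

/-- **Every adele of `E` is uniquely `(a ⊗ 1) + (b ⊗ 1) · δ`** with `a, b ∈ 𝔸_F`. [folklore] -/
theorem existsUnique_eq_adeleBaseChange_add [Algebra.IsQuadraticExtension F E] (σ : E ≃ₐ[F] E) {δ : E}
    (hσδ : σ δ = -δ) (hδ : δ ≠ 0) (y : AdeleRing (𝓞 E) E) :
    ∃! p : AdeleRing (𝓞 F) F × AdeleRing (𝓞 F) F,
      y = AdeleRing.baseChange F E p.1 + AdeleRing.baseChange F E p.2 * algebraMap E (AdeleRing (𝓞 E) E) δ := by
  refine ⟨(quadraticAdeleEquiv F E σ hσδ hδ).symm y, ?_, fun p hp => ?_⟩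
  · change y = _
    rw [← quadraticAdeleEquiv_apply E σ hσδ hδ, ContinuousAddEquiv.apply_symm_apply]
  · change y = _ at hp
    rw [← quadraticAdeleEquiv_apply E σ hσδ hδ] at hp
    rw [hp, ContinuousAddEquiv.symm_apply_apply]

/-- Parameter-free form: for a quadratic extension `E/F` of number fields, `𝔸_E ≅ 𝔸_F × 𝔸_F` as topological
groups, compatibly with `(· ⊗ 1)` on the first factor. [folklore] -/
theorem nonempty_quadraticAdeleEquiv [Algebra.IsQuadraticExtension F E] :
    ∃ (δ : E) (Ψ : (AdeleRing (𝓞 F) F × AdeleRing (𝓞 F) F) ≃ₜ+ AdeleRing (𝓞 E) E),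
      ∀ p, Ψ p = AdeleRing.baseChange F E p.1 + AdeleRing.baseChange F E p.2 * algebraMap E (AdeleRing (𝓞 E) E) δ := by
  obtain ⟨σ, δ, hσδ, hδ⟩ := exists_algEquiv_apply_eq_neg (F := F) (E := E)
  exact ⟨δ, quadraticAdeleEquiv F E σ hσδ hδ, quadraticAdeleEquiv_apply E σ hσδ hδ⟩

end Adele

end UnitaryGroup

end Literature.NumberTheory.Automorphic

end
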